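import Mathlib.Tactic.Ring
import Mathlib.Tactic.Linarith
import Mathlib.Logic.Relation
import Mathlib.Algebra.BigOperators.Ring.Finset
import Mathlib.Data.Fintype.Prod
import Mathlib.Data.Fintype.BigOperators
import HarnessLib

/-!
# Venture HSemireg — CROSS-ADDITIVITY: two unlinked rectangles with complete cross-feet force a slot-1 + slot-2 decomposition

Companion to `AdditiveNetClassDeath.lean` (THEOREM H-NET, k = 251), `NetPropagation.lean` (k = 252) and `LayerBlocks.lean` (k = 269) —
cell pub-hsemireg, seat p2 gen 15, HANDOFF-p2 §G15.6 («H-CROSS») and bus G15-RESULT 6 (kit j234518: at K1x's exact sieve tier there is a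
W-satisfying design whose three Weil layers are each TWO unlinked 3 × 3 rectangles with a Weil–Weil crossing at every doubly-footed curve —
no net partner, no axis partner — and yet every additive weighting of it is class-dead, by exact elimination).

SETTING (NET-REDUCTION-p2g14.md §0, §2c). Fix a sloped slot-3 line `m` whose Weil part is the disjoint union of two rectangles
`D₁ × C₁` and `D₂ × C₂` (THEOREM (LAYER BLOCKS)); at a doubly-footed curve `p × q × m` of `(ℓ, L) ∈ D₁ × C₁` the crossed partner is a
Weil triple `(ℓ*, L*) ∈ D₂ × C₂` with `p = ℓ ∩ ℓ*`, `q = L ∩ L*`, and ADDITIVITY there reads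
`w(ℓ,L,m) + w(ℓ*,L*,m) = a(p) + a′(q)` (pad weights).  «COMPLETE CROSS-FEET»: for any two rows `ℓ*, ℓ**` of `D₂` and two columns
`L*, L**` of `C₂` some `(ℓ, L) ∈ D₁ × C₁` is footed against all four (on the designs of record: the `D₁`-line of the third slope).

THIS FILE is the kernel form of the step «cross-additivity + complete cross-feet ⇒ on `D₂ × C₂` the weight is a sum of a slot-1 term
and a slot-2 term», as abstract bookkeeping: rows `R`, columns `C` (the rectangle `D₂ × C₂`), witnesses `R₁`, `C₁` (the lines of
`D₁`, `C₁`), footedness `FR ℓ r` («`ℓ ∩ r` is an A-foot of `m`»), `FC L c`, pad weights `a ℓ r`, `a' L c` at those feet, weights `w₁` on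
`D₁ × C₁` and `w` on `D₂ × C₂`.
* `interaction_eq_zero`: a common witness for two rows and two columns kills the 2 × 2 interaction of `w`;
* `exists_row_add_col`: complete cross-feet ⇒ `w r c = f r + g c` for some `f`, `g` — the hypothesis «net decomposition» of
  `AdditiveNetClassDeath.net_class_dead` for that rectangle (apply it per rectangle with balanced blocks and sum, NET-REDUCTION §2e), so
  «additive ⇒ class-dead» follows on such layers WITHOUT any net or axis partner.
What the kernel certifies: this bookkeeping; what it does not: that a given design has complete cross-feet or balanced blocks (census).

v2 (p2 gen 16) adds two sections to the same file.
§2 FOOTPRINT CONNECTIVITY.  The interaction lemma only needs, for a 2 × 2 sub-grid, ONE common footed witness; call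
such a sub-grid WITNESSED.  `exists_row_add_col_of_connected`: if there is a row relation `ER` whose equivalence closure is
everything and, for every `ER`-pair of rows, a column relation whose closure is everything such that all these 2 × 2 sub-grids
have vanishing interaction (e.g. are witnessed), then `w r c = f r + g c` — the 2 × 2 interaction is a cocycle in each pair of
arguments (`interaction_of_eqvGen_cols`, `interaction_of_eqvGen_rows`), so vanishing propagates along paths.  The net partner
(one witness for everything) and complete cross-feet (every 2 × 2 witnessed) are the two extreme cases; what a support has to
supply in general is only the CONNECTIVITY of its witnessed 2 × 2 system on each linked rectangle.
§3 CLASS DEATH PER RECTANGLE.  `rect_class_dead`: on a rectangle `R × C` with a class map `cls : R → C → K` whose rows and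
columns are class-balanced (each row meets every class equally often, each column likewise — for blocks with one line per slope
and `cls = s(ℓ) + s(L) + s(m) (mod 3)` every count is 1), a weight of the form `f r + g c` has equal class sums for all classes
(the per-rectangle reading of `AdditiveNetClassDeath.net_class_dead`, NET-REDUCTION §2e, proved here directly by double
counting); `cross_class_dead`: THEOREM H-CROSS assembled — cross-additivity + complete cross-feet in both directions + balanced
blocks ⇒ the class sums over the two rectangles together agree for all classes; `rects_class_dead`: any finite family of
rectangles each carrying a decomposition and balanced blocks is class-dead in total (so for THEOREM H at THEOREM F's tier the
one support-side item left is a decomposition on every linked rectangle, i.e. by §2 the connectivity of its witnessed system).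

HONEST FRAMING. Finite bookkeeping over the integers; no variety, cycle, cohomology class or semiregularity map occurs; nothing here bears
on HC ∕ HC_CM ∕ HC_AV.
-/

namespace Summit.Ventures.HSemireg
namespace AdditiveCrossDecomposition

variable {R C R₁ C₁ : Type*}

/-- **Interaction lemma.** If one witness pair `(ℓ, L)` is footed against the rows `r, r'` and the columns `c, c'`, then the
cross-additivity relations `w₁ ℓ L + w r c = a ℓ r + a' L c` at the four crossing curves force the 2 × 2 interaction of `w` to vanish. -/
theorem interaction_eq_zero (w₁ : R₁ → C₁ → ℤ) (w : R → C → ℤ) (a : R₁ → R → ℤ) (a' : C₁ → C → ℤ)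
    (FR : R₁ → R → Prop) (FC : C₁ → C → Prop)
    (cross : ∀ ℓ L r c, FR ℓ r → FC L c → w₁ ℓ L + w r c = a ℓ r + a' L c)
    {ℓ : R₁} {L : C₁} {r r' : R} {c c' : C}
    (hr : FR ℓ r) (hr' : FR ℓ r') (hc : FC L c) (hc' : FC L c') :
    w r c - w r c' - w r' c + w r' c' = 0 := by
  have h₁ := cross ℓ L r c hr hc
  have h₂ := cross ℓ L r c' hr hc'
  have h₃ := cross ℓ L r' c hr' hc
  have h₄ := cross ℓ L r' c' hr' hc'
  linarith

/-- **Cross-additivity with complete cross-feet ⇒ slot-1 + slot-2 decomposition.**  If every two rows and two columns of the rectangle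
have a common footed witness (`complete`), then the weight on the rectangle is `f r + g c` for some `f : R → ℤ`, `g : C → ℤ` — the net
decomposition used by `AdditiveNetClassDeath.net_class_dead`, obtained here from crossings instead of a net partner. -/
theorem exists_row_add_col (w₁ : R₁ → C₁ → ℤ) (w : R → C → ℤ) (a : R₁ → R → ℤ) (a' : C₁ → C → ℤ)
    (FR : R₁ → R → Prop) (FC : C₁ → C → Prop)
    (cross : ∀ ℓ L r c, FR ℓ r → FC L c → w₁ ℓ L + w r c = a ℓ r + a' L c)
    (complete : ∀ r r' : R, ∀ c c' : C, ∃ ℓ L, FR ℓ r ∧ FR ℓ r' ∧ FC L c ∧ FC L c') :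
    ∃ f : R → ℤ, ∃ g : C → ℤ, ∀ r c, w r c = f r + g c := by
  classical
  by_cases hR : Nonempty R
  · by_cases hC : Nonempty C
    · obtain ⟨r₀⟩ := hR
      obtain ⟨c₀⟩ := hC
      refine ⟨fun r => w r c₀, fun c => w r₀ c - w r₀ c₀, fun r c => ?_⟩
      obtain ⟨ℓ, L, hr, hr₀, hc, hc₀⟩ := complete r r₀ c c₀
      have h := interaction_eq_zero w₁ w a a' FR FC cross hr hr₀ hc hc₀
      linarith
    · exact ⟨fun _ => 0, fun _ => 0, fun r c => (hC ⟨c⟩).elim⟩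
  · exact ⟨fun _ => 0, fun _ => 0, fun r c => (hR ⟨r⟩).elim⟩

/-- **Symmetric form.**  With complete cross-feet in BOTH directions (witnesses in `D₂ × C₂` for the rectangle `D₁ × C₁` as well), both
rectangles carry a slot-1 + slot-2 decomposition. -/
theorem exists_row_add_col_both (w₁ : R₁ → C₁ → ℤ) (w : R → C → ℤ) (a : R₁ → R → ℤ) (a' : C₁ → C → ℤ)
    (FR : R₁ → R → Prop) (FC : C₁ → C → Prop)
    (cross : ∀ ℓ L r c, FR ℓ r → FC L c → w₁ ℓ L + w r c = a ℓ r + a' L c)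
    (complete₂ : ∀ r r' : R, ∀ c c' : C, ∃ ℓ L, FR ℓ r ∧ FR ℓ r' ∧ FC L c ∧ FC L c')
    (complete₁ : ∀ ℓ ℓ' : R₁, ∀ L L' : C₁, ∃ r c, FR ℓ r ∧ FR ℓ' r ∧ FC L c ∧ FC L' c) :
    (∃ f : R → ℤ, ∃ g : C → ℤ, ∀ r c, w r c = f r + g c) ∧
    (∃ f₁ : R₁ → ℤ, ∃ g₁ : C₁ → ℤ, ∀ ℓ L, w₁ ℓ L = f₁ ℓ + g₁ L) := by
  refine ⟨exists_row_add_col w₁ w a a' FR FC cross complete₂, ?_⟩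
  -- the mirrored statement: swap the roles of the two rectangles
  refine exists_row_add_col w w₁ (fun r ℓ => a ℓ r) (fun c L => a' L c) (fun r ℓ => FR ℓ r) (fun c L => FC L c) ?_ complete₁
  intro r c ℓ L hr hc
  have h := cross ℓ L r c hr hc
  linarith

/-! ## §2 Footprint connectivity: decomposition from any connected system of 2 × 2 sub-grids with vanishing interaction -/

/-- The 2 × 2 interaction is a cocycle in the column pair: if it vanishes on the pairs of a column relation `E` (rows `r, r'`
fixed), it vanishes on the equivalence closure of `E`. -/
theorem interaction_of_eqvGen_cols (w : R → C → ℤ) {r r' : R} (E : C → C → Prop)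
    (hE : ∀ c c', E c c' → w r c - w r c' - w r' c + w r' c' = 0) {c c' : C}
    (h : Relation.EqvGen E c c') : w r c - w r c' - w r' c + w r' c' = 0 := by
  induction h with
  | rel x y hxy => exact hE x y hxy
  | refl x => ring
  | symm x y _ ih => linarith
  | trans x y z _ _ ih₁ ih₂ => linarith

/-- The 2 × 2 interaction is a cocycle in the row pair: if it vanishes on the pairs of a row relation `E` (columns `c, c'`
fixed), it vanishes on the equivalence closure of `E`. -/
theorem interaction_of_eqvGen_rows (w : R → C → ℤ) {c c' : C} (E : R → R → Prop)
    (hE : ∀ r r', E r r' → w r c - w r c' - w r' c + w r' c' = 0) {r r' : R}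
    (h : Relation.EqvGen E r r') : w r c - w r c' - w r' c + w r' c' = 0 := by
  induction h with
  | rel x y hxy => exact hE x y hxy
  | refl x => ring
  | symm x y _ ih => linarith
  | trans x y z _ _ ih₁ ih₂ => linarith

/-- **Decomposition from a connected system.**  Let `ER` be a row relation whose equivalence closure is all of `R × R`, and for
every `ER`-related pair of rows `r, r'` let `EC r r'` be a column relation whose equivalence closure is all of `C × C`, such that
the interaction of `w` vanishes on every sub-grid `{r, r'} × {c, c'}` with `ER r r'` and `EC r r' c c'` (for instance because it
is witnessed, `interaction_eq_zero`).  Then `w r c = f r + g c` for some `f`, `g`. -/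
theorem exists_row_add_col_of_connected (w : R → C → ℤ) (ER : R → R → Prop) (EC : R → R → C → C → Prop)
    (hZ : ∀ r r' c c', ER r r' → EC r r' c c' → w r c - w r c' - w r' c + w r' c' = 0)
    (hC : ∀ r r', ER r r' → ∀ c c', Relation.EqvGen (EC r r') c c')
    (hR : ∀ r r', Relation.EqvGen ER r r') :
    ∃ f : R → ℤ, ∃ g : C → ℤ, ∀ r c, w r c = f r + g c := by
  classical
  -- step 1: for ER-related rows the interaction vanishes for ALL column pairs (paths in the columns)
  have h₁ : ∀ r r', ER r r' → ∀ c c', w r c - w r c' - w r' c + w r' c' = 0 :=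
    fun r r' hrr' c c' => interaction_of_eqvGen_cols w (EC r r') (fun x y hxy => hZ r r' x y hrr' hxy) (hC r r' hrr' c c')
  -- step 2: hence for ALL rows (paths in the rows, columns fixed)
  have h₂ : ∀ (c c' : C) (r r' : R), w r c - w r c' - w r' c + w r' c' = 0 :=
    fun c c' r r' => interaction_of_eqvGen_rows w ER (fun x y hxy => h₁ x y hxy c c') (hR r r')
  by_cases hRn : Nonempty R
  · by_cases hCn : Nonempty C
    · obtain ⟨r₀⟩ := hRn
      obtain ⟨c₀⟩ := hCn
      refine ⟨fun r => w r c₀, fun c => w r₀ c - w r₀ c₀, fun r c => ?_⟩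
      have h := h₂ c c₀ r r₀
      linarith
    · exact ⟨fun _ => 0, fun _ => 0, fun r c => (hCn ⟨c⟩).elim⟩
  · exact ⟨fun _ => 0, fun _ => 0, fun r c => (hRn ⟨r⟩).elim⟩

/-- **Footed form.**  With the cross-additivity relations of §1: if `ER`, `EC` are as above and every sub-grid
`{r, r'} × {c, c'}` with `ER r r'`, `EC r r' c c'` has a common footed witness `(ℓ, L)`, the weight on the rectangle decomposes.
`exists_row_add_col` is the case `ER = EC = ⊤` (complete cross-feet); a net partner is the case of ONE witness for all. -/
theorem exists_row_add_col_of_witnessed (w₁ : R₁ → C₁ → ℤ) (w : R → C → ℤ) (a : R₁ → R → ℤ) (a' : C₁ → C → ℤ)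
    (FR : R₁ → R → Prop) (FC : C₁ → C → Prop)
    (cross : ∀ ℓ L r c, FR ℓ r → FC L c → w₁ ℓ L + w r c = a ℓ r + a' L c)
    (ER : R → R → Prop) (EC : R → R → C → C → Prop)
    (witnessed : ∀ r r' c c', ER r r' → EC r r' c c' → ∃ ℓ L, FR ℓ r ∧ FR ℓ r' ∧ FC L c ∧ FC L c')
    (hC : ∀ r r', ER r r' → ∀ c c', Relation.EqvGen (EC r r') c c')
    (hR : ∀ r r', Relation.EqvGen ER r r') :
    ∃ f : R → ℤ, ∃ g : C → ℤ, ∀ r c, w r c = f r + g c := by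
  refine exists_row_add_col_of_connected w ER EC (fun r r' c c' hrr' hcc' => ?_) hC hR
  obtain ⟨ℓ, L, hr, hr', hc, hc'⟩ := witnessed r r' c c' hrr' hcc'
  exact interaction_eq_zero w₁ w a a' FR FC cross hr hr' hc hc'

/-! ## §3 Class death per rectangle, and THEOREM H-CROSS assembled -/

section ClassDeath

open Finset

variable {K : Type*} [DecidableEq K]

/-- **Class death on one rectangle.**  If `w r c = f r + g c` on `R × C` and every row and every column of the class map
`cls` is balanced (meets all classes equally often), then the class sums `∑_{cls = k} w` agree for all `k`.
[Per-rectangle form of `AdditiveNetClassDeath.net_class_dead` (NET-REDUCTION-p2g14.md §2e); for blocks with one line per slope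
and `cls (ℓ, L) = s(ℓ) + s(L) + s(m) (mod 3)` all the counts are `1`.] -/
theorem rect_class_dead [Fintype R] [Fintype C] (cls : R → C → K) (w : R → C → ℤ) (f : R → ℤ) (g : C → ℤ)
    (hdec : ∀ r c, w r c = f r + g c)
    (hrow : ∀ (r : R) (k k' : K),
      (univ.filter fun c => cls r c = k).card = (univ.filter fun c => cls r c = k').card)
    (hcol : ∀ (c : C) (k k' : K),
      (univ.filter fun r => cls r c = k).card = (univ.filter fun r => cls r c = k').card)
    (k k' : K) :
    ∑ p ∈ univ.filter (fun p : R × C => cls p.1 p.2 = k), w p.1 p.2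
      = ∑ p ∈ univ.filter (fun p : R × C => cls p.1 p.2 = k'), w p.1 p.2 := by
  -- class sum = (row part, counted by the row's class multiplicity) + (column part, likewise)
  have key : ∀ k : K, ∑ p ∈ univ.filter (fun p : R × C => cls p.1 p.2 = k), w p.1 p.2
      = ∑ r, ((univ.filter fun c => cls r c = k).card : ℤ) * f r
        + ∑ c, ((univ.filter fun r => cls r c = k).card : ℤ) * g c := by
    intro k
    have h1 : ∀ r c, (if cls r c = k then w r c else 0)
        = (if cls r c = k then f r else 0) + (if cls r c = k then g c else 0) := by
      intro r c
      split_ifs with h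
      · exact hdec r c
      · simp
    rw [Finset.sum_filter, Fintype.sum_prod_type]
    simp only [h1, Finset.sum_add_distrib]
    congr 1
    · refine Finset.sum_congr rfl fun r _ => ?_
      rw [← Finset.sum_filter, Finset.sum_const, nsmul_eq_mul]
    · rw [Finset.sum_comm]
      refine Finset.sum_congr rfl fun c _ => ?_
      rw [← Finset.sum_filter, Finset.sum_const, nsmul_eq_mul]
  rw [key k, key k']
  congr 1
  · exact sum_congr rfl fun r _ => by rw [hrow r k k']
  · exact sum_congr rfl fun c _ => by rw [hcol c k k']

/-- **A family of rectangles.**  If every rectangle `i` of a finite family carries a decomposition `w i r c = f r + g c` and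
balanced rows and columns, the total class sums over the family agree for all classes.  [So for «additive ⇒ class-dead» at
THEOREM F's tier (blocks balanced) the only support-side item is a decomposition on every linked rectangle of every layer —
by §2, the connectivity of its witnessed 2 × 2 system.] -/
theorem rects_class_dead {ι : Type*} (S : Finset ι) (Rw : ι → Type*) (Cl : ι → Type*)
    [∀ i, Fintype (Rw i)] [∀ i, Fintype (Cl i)]
    (cls : ∀ i, Rw i → Cl i → K) (w : ∀ i, Rw i → Cl i → ℤ)
    (hdec : ∀ i ∈ S, ∃ f : Rw i → ℤ, ∃ g : Cl i → ℤ, ∀ r c, w i r c = f r + g c)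
    (hrow : ∀ i ∈ S, ∀ (r : Rw i) (k k' : K),
      (univ.filter fun c => cls i r c = k).card = (univ.filter fun c => cls i r c = k').card)
    (hcol : ∀ i ∈ S, ∀ (c : Cl i) (k k' : K),
      (univ.filter fun r => cls i r c = k).card = (univ.filter fun r => cls i r c = k').card)
    (k k' : K) :
    ∑ i ∈ S, ∑ p ∈ univ.filter (fun p : Rw i × Cl i => cls i p.1 p.2 = k), w i p.1 p.2
      = ∑ i ∈ S, ∑ p ∈ univ.filter (fun p : Rw i × Cl i => cls i p.1 p.2 = k'), w i p.1 p.2 := by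
  refine sum_congr rfl fun i hi => ?_
  obtain ⟨f, g, hfg⟩ := hdec i hi
  exact rect_class_dead (cls i) (w i) f g hfg (hrow i hi) (hcol i hi) k k'

/-- **THEOREM H-CROSS (assembled).**  Two unlinked rectangles `R₁ × C₁` and `R × C` of one layer with cross-additivity at the
crossing curves, complete cross-feet in both directions, and class-balanced rows and columns on both rectangles (balanced
blocks): the class sums of the weights over the two rectangles together agree for all classes — «additive ⇒ class-dead» on such
a layer without any net or axis partner (CROSSING-p2g15.md §2; the design B2 of kit j234518 has this shape in all three Weil
layers). -/
theorem cross_class_dead [Fintype R] [Fintype C] [Fintype R₁] [Fintype C₁]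
    (cls₁ : R₁ → C₁ → K) (cls : R → C → K)
    (w₁ : R₁ → C₁ → ℤ) (w : R → C → ℤ) (a : R₁ → R → ℤ) (a' : C₁ → C → ℤ)
    (FR : R₁ → R → Prop) (FC : C₁ → C → Prop)
    (cross : ∀ ℓ L r c, FR ℓ r → FC L c → w₁ ℓ L + w r c = a ℓ r + a' L c)
    (complete₂ : ∀ r r' : R, ∀ c c' : C, ∃ ℓ L, FR ℓ r ∧ FR ℓ r' ∧ FC L c ∧ FC L c')
    (complete₁ : ∀ ℓ ℓ' : R₁, ∀ L L' : C₁, ∃ r c, FR ℓ r ∧ FR ℓ' r ∧ FC L c ∧ FC L' c)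
    (hrow₁ : ∀ (ℓ : R₁) (k k' : K),
      (univ.filter fun L => cls₁ ℓ L = k).card = (univ.filter fun L => cls₁ ℓ L = k').card)
    (hcol₁ : ∀ (L : C₁) (k k' : K),
      (univ.filter fun ℓ => cls₁ ℓ L = k).card = (univ.filter fun ℓ => cls₁ ℓ L = k').card)
    (hrow₂ : ∀ (r : R) (k k' : K),
      (univ.filter fun c => cls r c = k).card = (univ.filter fun c => cls r c = k').card)
    (hcol₂ : ∀ (c : C) (k k' : K),
      (univ.filter fun r => cls r c = k).card = (univ.filter fun r => cls r c = k').card)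
    (k k' : K) :
    ∑ p ∈ univ.filter (fun p : R₁ × C₁ => cls₁ p.1 p.2 = k), w₁ p.1 p.2
        + ∑ p ∈ univ.filter (fun p : R × C => cls p.1 p.2 = k), w p.1 p.2
      = ∑ p ∈ univ.filter (fun p : R₁ × C₁ => cls₁ p.1 p.2 = k'), w₁ p.1 p.2
        + ∑ p ∈ univ.filter (fun p : R × C => cls p.1 p.2 = k'), w p.1 p.2 := by
  obtain ⟨⟨f, g, hfg⟩, ⟨f₁, g₁, hfg₁⟩⟩ :=
    exists_row_add_col_both w₁ w a a' FR FC cross complete₂ complete₁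
  rw [rect_class_dead cls₁ w₁ f₁ g₁ hfg₁ hrow₁ hcol₁ k k', rect_class_dead cls w f g hfg hrow₂ hcol₂ k k']

end ClassDeath

end AdditiveCrossDecomposition
end Summit.Ventures.HSemireg
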